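import Summits.HodgeConjecture.HodgeConjecture.Theorems.K2E3WittLeviCartanLabels
import HarnessLib

/-!
# The maximal parabolic `Q_c` of `U(σ, W)` for a Witt form WITH ANISOTROPIC KERNEL (`W = wittFormOn e Han`, standard `e`, any `m`):
# block entries of `W`, the middle block of a block-triangular `W`-unitary matrix is `W′`-unitary, and `diag(A, g′, A†)` (crux H413, 13a road A, (D) prep)

Cell `hodgecm-mathlib`, Track B, line `K2_E3_EllipticInputs`, 13a road A; seat K2E3-p10 (g3).  THEOREMS ONLY; count-neutral helper.

★ `HermitianLattice.HyperspecialUnitaryParabolicBlocks` treats `Q_c = GL_c × U(J₀^{(N−2c)}) ⋉ N_c` for the SPLIT form `J₀`.  For the non-quasi-split Witt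
type `m = 2` (and uniformly for every `m`) the middle block carries the kernel: in a standard indexing `e : WittIndex r m ≃ Fin N` the Witt form is
«antidiagonal on the outer frame `[0,c) ∪ [N−c,N)`, the SHIFTED Witt form `W′ = wittFormOn (stdWittEquivFin (r−c) m _) Han` on the middle block» (§1).  Hence
(§2) the unitarity identity `σ(M)ᵀ W M = W` splits over the three blocks, and (§3) the middle block of a block upper triangular `W`-unitary matrix is
`W′`-unitary — the Levi projection `Q_c → U(σ, W′)` at the level of matrices (the form-independent block bookkeeping `blockLabel ∕ castLE ∕ midIndex ∕ hiIndex ∕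
loBlock ∕ midBlock ∕ blockDiagMatrix ∕ dualBlock` of ★ is reused verbatim), and (§4) the block-diagonal lift `diag(A, g′, A†)` is `W`-unitary when `g′` is
`W′`-unitary.  Sequel (planned): `GL ∕ U` packaging, rigidity, and the Levi Cartan recursion for `m = 2` over the (D) lattice theory.

References: F. Bruhat, J. Tits (1972), (4.4.3); J. Rogawski (1990), §1.9–§1.10; A. Borel (1991), §23; J. Dieudonné (1971), Chap. I §11.
-/

set_option autoImplicit false
set_option linter.dupNamespace false

noncomputable section

open scoped Matrix MatrixGroups
open Matrix

namespace Summit.HodgeConjecture.HodgeConjecture.Cruxes.H413.K2E3WittParabolicBlocks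

open Literature.NumberTheory.Automorphic Literature.NumberTheory.Automorphic.HermitianLattice
open K2E3LocalUnitaryWitt K2E3WittCartanUnramified

/-! ## §1 Entries of the Witt form in a standard indexing -/

section Entries

variable {R : Type*} [CommRing R] {N r m : ℕ} (e : WittIndex r m ≃ Fin N)
  (hstd : ∀ x, (e x).val = Sum.elim (fun i : Fin r => i.val) (Sum.elim (fun u : Fin m => r + u.val) (fun j : Fin r => r + m + j.val)) x)
  (Han : Matrix (Fin m) (Fin m) R)

include hstd in
/-- **Row `e_i` of the Witt form**: `W (e_i) q = [q = rev (e_i)]` (the partner of `e_i` is the `f`-slot at the mirror position). [cite: Dieudonne1971GroupesClassiques, Chap. I §11] -/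
theorem wittFormOn_apply_inl (i : Fin r) (q : Fin N) : wittFormOn e Han (e (Sum.inl i)) q = if q = Fin.rev (e (Sum.inl i)) then 1 else 0 := by
  obtain ⟨y, rfl⟩ := e.surjective q
  rw [wittFormOn_apply, e.symm_apply_apply, e.symm_apply_apply, rev_apply_inl e hstd]
  rcases y with i' | u' | j'
  · rw [wittForm_inl_inl, if_neg (fun h => Sum.inl_ne_inr (e.injective h))]
  · rw [wittForm_inl_inr_inl, if_neg (fun h => by have := e.injective h; simp at this)]
  · rw [wittForm_inl_inr_inr]
    by_cases h : i = Fin.rev j'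
    · rw [if_pos h, if_pos (by rw [h, Fin.rev_rev])]
    · rw [if_neg h, if_neg (fun h' => h (by have := e.injective h'; simp only [Sum.inr.injEq] at this; rw [this, Fin.rev_rev]))]

include hstd in
/-- **Row of an `f`-slot**: `W (f_j) q = [q = rev (f_j)]`. [cite: Dieudonne1971GroupesClassiques, Chap. I §11] -/
theorem wittFormOn_apply_inr_inr (j : Fin r) (q : Fin N) :
    wittFormOn e Han (e (Sum.inr (Sum.inr j))) q = if q = Fin.rev (e (Sum.inr (Sum.inr j))) then 1 else 0 := by
  obtain ⟨y, rfl⟩ := e.surjective q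
  rw [wittFormOn_apply, e.symm_apply_apply, e.symm_apply_apply, rev_apply_inr_inr e hstd]
  rcases y with i' | u' | j'
  · rw [wittForm_inr_inr_inl]
    by_cases h : j = Fin.rev i'
    · rw [if_pos h, if_pos (by rw [h, Fin.rev_rev])]
    · rw [if_neg h, if_neg (fun h' => h (by have := e.injective h'; simp only [Sum.inl.injEq] at this; rw [this, Fin.rev_rev]))]
  · rw [wittForm_inr_inr_inr_inl, if_neg (fun h => by have := e.injective h; simp at this)]
  · rw [wittForm_inr_inr_inr_inr, if_neg (fun h => by have := e.injective h; simp at this)]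

/-- **Row of a kernel index**: `W (u) (u′) = Han u u′` and `W (u) q = 0` off the kernel. [cite: Dieudonne1971GroupesClassiques, Chap. I §11] -/
theorem wittFormOn_apply_inr_inl (u : Fin m) (q : Fin N) :
    wittFormOn e Han (e (Sum.inr (Sum.inl u))) q =
      Sum.elim (fun _ : Fin r => (0 : R)) (Sum.elim (fun u' : Fin m => Han u u') (fun _ : Fin r => 0)) (e.symm q) := by
  obtain ⟨y, rfl⟩ := e.surjective q
  rw [wittFormOn_apply, e.symm_apply_apply, e.symm_apply_apply]
  rcases y with i' | u' | j'
  · rw [wittForm_inr_inl_inl]; rfl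
  · rw [wittForm_inr_inl_inr_inl]; rfl
  · rw [wittForm_inr_inl_inr_inr]; rfl

/-- **The Witt form is symmetric off the kernel and hermitian symmetry is not needed there**: `W p q = W q p` whenever one index is not a kernel index.
Precisely: `W q (e_i) = W (e_i) q` and `W q (f_j) = W (f_j) q`. [cite: Dieudonne1971GroupesClassiques, Chap. I §11] -/
theorem wittFormOn_apply_comm_inl (i : Fin r) (q : Fin N) : wittFormOn e Han q (e (Sum.inl i)) = wittFormOn e Han (e (Sum.inl i)) q := by
  obtain ⟨y, rfl⟩ := e.surjective q
  rw [wittFormOn_apply, wittFormOn_apply, e.symm_apply_apply, e.symm_apply_apply]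
  rcases y with i' | u' | j'
  · rw [wittForm_inl_inl, wittForm_inl_inl]
  · rw [wittForm_inr_inl_inl, wittForm_inl_inr_inl]
  · rw [wittForm_inr_inr_inl, wittForm_inl_inr_inr]
    by_cases h : j' = Fin.rev i
    · rw [if_pos h, if_pos (by rw [h, Fin.rev_rev])]
    · rw [if_neg h, if_neg (fun h' => h (by rw [h', Fin.rev_rev]))]

/-- `W q (f_j) = W (f_j) q`. [cite: Dieudonne1971GroupesClassiques, Chap. I §11] -/
theorem wittFormOn_apply_comm_inr_inr (j : Fin r) (q : Fin N) :
    wittFormOn e Han q (e (Sum.inr (Sum.inr j))) = wittFormOn e Han (e (Sum.inr (Sum.inr j))) q := by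
  obtain ⟨y, rfl⟩ := e.surjective q
  rw [wittFormOn_apply, wittFormOn_apply, e.symm_apply_apply, e.symm_apply_apply]
  rcases y with i' | u' | j'
  · rw [wittForm_inl_inr_inr, wittForm_inr_inr_inl]
    by_cases h : i' = Fin.rev j
    · rw [if_pos h, if_pos (by rw [h, Fin.rev_rev])]
    · rw [if_neg h, if_neg (fun h' => h (by rw [h', Fin.rev_rev]))]
  · rw [wittForm_inr_inl_inr_inr, wittForm_inr_inr_inr_inl]
  · rw [wittForm_inr_inr_inr_inr, wittForm_inr_inr_inr_inr]

/-- **The unitarity form, one outer column**: for a hyperbolic index `p = e_i` or `f_j`, `(σ(M)ᵀ W M)_{ab}` receives from row `p` exactly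
`σ(M_{p a}) M_{rev p, b}`: `∑_l W p l M l b = M (rev p) b`. [cite: Rogawski1990, §1.9] -/
theorem sum_wittFormOn_mul_of_eq_ite {p : Fin N} (hp : ∀ q, wittFormOn e Han p q = if q = Fin.rev p then 1 else 0) (M : Matrix (Fin N) (Fin N) R)
    (b : Fin N) : ∑ l, wittFormOn e Han p l * M l b = M (Fin.rev p) b := by
  rw [Finset.sum_eq_single (Fin.rev p)]
  · rw [hp, if_pos rfl, one_mul]
  · intro l _ hl; rw [hp, if_neg hl, zero_mul]
  · intro h; exact absurd (Finset.mem_univ _) h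

end Entries

/-! ## §2 The three blocks of `Q_c` (`c ≤ r`): outer frame antidiagonal, middle block = the shifted Witt form `W′` -/

section Blocks

variable {R : Type*} [CommRing R] {N r m : ℕ} (e : WittIndex r m ≃ Fin N)
  (hstd : ∀ x, (e x).val = Sum.elim (fun i : Fin r => i.val) (Sum.elim (fun u : Fin m => r + u.val) (fun j : Fin r => r + m + j.val)) x)
  (Han : Matrix (Fin m) (Fin m) R) {c : ℕ} (hcr : c ≤ r) (hc : 2 * c ≤ N) (hN' : (r - c) + (m + (r - c)) = N - 2 * c)

include hstd hcr in
/-- The first block consists of `e`-indices: `castLE i = e (e_i)`. [cite: Borel1991, §23] -/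
theorem castLE_eq_apply_inl (i : Fin c) : Fin.castLE (le_of_two_mul_le hc) i = e (Sum.inl ⟨i.val, lt_of_lt_of_le i.isLt hcr⟩) :=
  Fin.ext (by rw [hstd]; simp)

include hstd hcr in
/-- The last block consists of `f`-slots: `hiIndex i = e (f`-slot `(r − c + i))`. [cite: Borel1991, §23] -/
theorem hiIndex_eq_apply_inr_inr (i : Fin c) :
    hiIndex hc i = e (Sum.inr (Sum.inr ⟨r - c + i.val, by have := i.isLt; omega⟩)) := by
  have hN : N = r + (m + r) := by simpa using (Fintype.card_congr e).symm
  apply Fin.ext; rw [coe_hiIndex, hstd]; simp only [Sum.elim_inr]; omega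

include hstd hcr hN' in
/-- **The middle block in Witt coordinates**: `e⁻¹ (midIndex j)` is the SHIFT of `e′⁻¹ j` (`e′ = stdWittEquivFin (r − c) m`): `e_{i′} ↦ e_{c+i′}`, kernel `u ↦ u`,
`f`-slot `j″ ↦ j″`. Stated as the three value identities. [cite: Borel1991, §23] -/
theorem symm_midIndex_eq (j : Fin (N - 2 * c)) :
    e.symm (midIndex hc j) = Sum.elim (fun i' : Fin (r - c) => (Sum.inl ⟨c + i'.val, by have := i'.isLt; omega⟩ : WittIndex r m))
      (Sum.elim (fun u : Fin m => Sum.inr (Sum.inl u)) (fun j'' : Fin (r - c) => Sum.inr (Sum.inr ⟨j''.val, by have := j''.isLt; omega⟩)))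
      ((stdWittEquivFin (r - c) m hN').symm j) := by
  have hN : N = r + (m + r) := by simpa using (Fintype.card_congr e).symm
  have hstd' := stdWittEquivFin_hstd (r - c) m hN'
  obtain ⟨y, rfl⟩ := (stdWittEquivFin (r - c) m hN').surjective j
  rw [Equiv.symm_apply_apply, Equiv.symm_apply_eq]
  apply Fin.ext
  rw [coe_midIndex, hstd', hstd]
  rcases y with i' | u | j'' <;> simp only [Sum.elim_inl, Sum.elim_inr] <;> omega

include hstd hcr hN' in
/-- **The middle block of the Witt form is the shifted Witt form `W′`.** [cite: Dieudonne1971GroupesClassiques, Chap. I §11] -/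
theorem wittFormOn_midIndex_midIndex (j j' : Fin (N - 2 * c)) :
    wittFormOn e Han (midIndex hc j) (midIndex hc j') = wittFormOn (stdWittEquivFin (r - c) m hN') Han j j' := by
  rw [wittFormOn_apply, wittFormOn_apply, symm_midIndex_eq e hstd hcr hc hN', symm_midIndex_eq e hstd hcr hc hN']
  rcases (stdWittEquivFin (r - c) m hN').symm j with i₁ | u₁ | j₁ <;> rcases (stdWittEquivFin (r - c) m hN').symm j' with i₂ | u₂ | j₂ <;>
    simp only [Sum.elim_inl, Sum.elim_inr, wittForm_inl_inl, wittForm_inl_inr_inl, wittForm_inl_inr_inr, wittForm_inr_inl_inl,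
      wittForm_inr_inl_inr_inl, wittForm_inr_inl_inr_inr, wittForm_inr_inr_inl, wittForm_inr_inr_inr_inl, wittForm_inr_inr_inr_inr]
  · -- `e`-`f`
    have h1 := i₁.isLt; have h2 := j₂.isLt
    by_cases h : (⟨c + i₁.val, by omega⟩ : Fin r) = Fin.rev ⟨j₂.val, by omega⟩
    · rw [if_pos h, if_pos]; apply Fin.ext; have := congrArg Fin.val h; simp only [Fin.val_rev] at this ⊢; omega
    · rw [if_neg h, if_neg]; intro h'; apply h; apply Fin.ext; have := congrArg Fin.val h'; simp only [Fin.val_rev] at this ⊢; omega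
  · -- `f`-`e`
    have h1 := j₁.isLt; have h2 := i₂.isLt
    by_cases h : (⟨j₁.val, by omega⟩ : Fin r) = Fin.rev ⟨c + i₂.val, by omega⟩
    · rw [if_pos h, if_pos]; apply Fin.ext; have := congrArg Fin.val h; simp only [Fin.val_rev] at this ⊢; omega
    · rw [if_neg h, if_neg]; intro h'; apply h; apply Fin.ext; have := congrArg Fin.val h'; simp only [Fin.val_rev] at this ⊢; omega

include hstd hcr hc in
/-- Rows of the outer frame are antidiagonal: for `blockLabel p ≠ 1`, `W p q = [q = rev p]`. [cite: Dieudonne1971GroupesClassiques, Chap. I §11] -/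
theorem wittFormOn_apply_of_blockLabel_ne_one {p : Fin N} (hp : blockLabel N c p ≠ 1) (q : Fin N) :
    wittFormOn e Han p q = if q = Fin.rev p then 1 else 0 := by
  have hN : N = r + (m + r) := by simpa using (Fintype.card_congr e).symm
  rcases Nat.lt_or_ge (blockLabel N c p) 1 with h0 | h2
  · have hp0 : (p : ℕ) < c := (blockLabel_eq_zero_iff p).1 (by omega)
    obtain ⟨i, rfl⟩ : ∃ i : Fin c, Fin.castLE (le_of_two_mul_le hc) i = p := ⟨⟨p, hp0⟩, Fin.ext rfl⟩
    rw [castLE_eq_apply_inl e hstd hcr hc]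
    exact wittFormOn_apply_inl e hstd Han _ q
  · have hp2 : N ≤ (p : ℕ) + c := (blockLabel_eq_two_iff hc p).1 (by have := blockLabel_le_two (c := c) p; omega)
    obtain ⟨i, rfl⟩ : ∃ i : Fin c, hiIndex hc i = p := ⟨⟨p + c - N, by omega⟩, Fin.ext (by simp; omega)⟩
    rw [hiIndex_eq_apply_inr_inr e hstd hcr hc]
    exact wittFormOn_apply_inr_inr e hstd Han _ q

include hstd hcr hc in
/-- Columns of the outer frame are antidiagonal: for `blockLabel q ≠ 1`, `W p q = [p = rev q]`. [cite: Dieudonne1971GroupesClassiques, Chap. I §11] -/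
theorem wittFormOn_apply_of_blockLabel_ne_one' {q : Fin N} (hq : blockLabel N c q ≠ 1) (p : Fin N) :
    wittFormOn e Han p q = if p = Fin.rev q then 1 else 0 := by
  have hN : N = r + (m + r) := by simpa using (Fintype.card_congr e).symm
  rcases Nat.lt_or_ge (blockLabel N c q) 1 with h0 | h2
  · have hq0 : (q : ℕ) < c := (blockLabel_eq_zero_iff q).1 (by omega)
    obtain ⟨i, rfl⟩ : ∃ i : Fin c, Fin.castLE (le_of_two_mul_le hc) i = q := ⟨⟨q, hq0⟩, Fin.ext rfl⟩
    rw [castLE_eq_apply_inl e hstd hcr hc, wittFormOn_apply_comm_inl, wittFormOn_apply_inl e hstd Han]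
  · have hq2 : N ≤ (q : ℕ) + c := (blockLabel_eq_two_iff hc q).1 (by have := blockLabel_le_two (c := c) q; omega)
    obtain ⟨i, rfl⟩ : ∃ i : Fin c, hiIndex hc i = q := ⟨⟨q + c - N, by omega⟩, Fin.ext (by simp; omega)⟩
    rw [hiIndex_eq_apply_inr_inr e hstd hcr hc, wittFormOn_apply_comm_inr_inr, wittFormOn_apply_inr_inr e hstd Han]

include hstd hcr in
/-- The middle block is orthogonal to the outer frame: `W (midIndex j) q = 0` for `blockLabel q ≠ 1`. [cite: Dieudonne1971GroupesClassiques, Chap. I §11] -/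
theorem wittFormOn_midIndex_of_blockLabel_ne_one (j : Fin (N - 2 * c)) {q : Fin N} (hq : blockLabel N c q ≠ 1) : wittFormOn e Han (midIndex hc j) q = 0 := by
  rw [wittFormOn_apply_of_blockLabel_ne_one' e hstd Han hcr hc hq, if_neg]
  intro h
  have := congrArg (blockLabel N c) h
  rw [blockLabel_midIndex, blockLabel_rev hc] at this
  have := blockLabel_le_two (c := c) q
  omega

include hstd hcr hN' in
/-- **The unitarity form of the Witt form, split over the three blocks**: `(σ(M)ᵀ W M)_{ab} = Σ_{k outer} σ(M_{ka}) M_{rev k, b} + Σ_{j,j′} σ(M_{midIndex j, a}) W′_{jj′} M_{midIndex j′, b}`.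
[cite: Rogawski1990, §1.9–§1.10] -/
theorem map_transpose_mul_wittFormOn_mul_apply (σ : R →+* R) (M : Matrix (Fin N) (Fin N) R) (a b : Fin N) :
    ((M.map σ)ᵀ * wittFormOn e Han * M) a b =
      (∑ i : Fin c, σ (M (Fin.castLE (le_of_two_mul_le hc) i) a) * M (Fin.rev (Fin.castLE (le_of_two_mul_le hc) i)) b) +
      (∑ j : Fin (N - 2 * c), σ (M (midIndex hc j) a) * ∑ j' : Fin (N - 2 * c), wittFormOn (stdWittEquivFin (r - c) m hN') Han j j' * M (midIndex hc j') b) +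
      ∑ i : Fin c, σ (M (hiIndex hc i) a) * M (Fin.rev (hiIndex hc i)) b := by
  rw [Matrix.mul_assoc, Matrix.mul_apply]
  have hterm : ∀ k : Fin N, (M.map σ)ᵀ a k * (wittFormOn e Han * M) k b = σ (M k a) * ∑ l, wittFormOn e Han k l * M l b := fun k => by
    rw [Matrix.transpose_apply, Matrix.map_apply, Matrix.mul_apply]
  simp only [hterm]
  rw [sum_eq_sum_blocks hc]
  congr 1; congr 1
  · refine Finset.sum_congr rfl fun i _ => ?_
    rw [sum_wittFormOn_mul_of_eq_ite e Han (wittFormOn_apply_of_blockLabel_ne_one e hstd Han hcr hc (by rw [blockLabel_castLE hc]; decide))]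
  · refine Finset.sum_congr rfl fun j _ => ?_
    congr 1
    rw [sum_eq_sum_midIndex_of hc]
    · exact Finset.sum_congr rfl fun j' _ => by rw [wittFormOn_midIndex_midIndex e hstd Han hcr hc hN']
    · intro l hl; rw [wittFormOn_midIndex_of_blockLabel_ne_one e hstd Han hcr hc j (by rw [(blockLabel_eq_zero_iff l).2 hl]; decide), zero_mul]
    · intro l hl; rw [wittFormOn_midIndex_of_blockLabel_ne_one e hstd Han hcr hc j (by rw [(blockLabel_eq_two_iff hc l).2 hl]; decide), zero_mul]
  · refine Finset.sum_congr rfl fun i _ => ?_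
    rw [sum_wittFormOn_mul_of_eq_ite e Han (wittFormOn_apply_of_blockLabel_ne_one e hstd Han hcr hc (by rw [blockLabel_hiIndex hc]; decide))]

include hstd hcr hN' in
/-- **The middle block of a block upper triangular `W`-unitary matrix is `W′`-unitary** (the Levi projection `Q_c → U(σ, W′)` on matrices: in the
unitarity identity at `(midIndex j, midIndex j′)` the outer-frame terms vanish because a block upper triangular matrix has no `(last block, middle block)`
entries). [cite: Rogawski1990, §1.10] [cite: BruhatTits1972, (4.4.3)] -/
theorem midBlock_unitary_witt (σ : R →+* R) {q : Matrix (Fin N) (Fin N) R} (hq : q.BlockTriangular (blockLabel N c))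
    (hu : (q.map σ)ᵀ * wittFormOn e Han * q = wittFormOn e Han) :
    ((midBlock hc q).map σ)ᵀ * wittFormOn (stdWittEquivFin (r - c) m hN') Han * midBlock hc q = wittFormOn (stdWittEquivFin (r - c) m hN') Han := by
  ext j j'
  have h := congrFun (congrFun hu (midIndex hc j)) (midIndex hc j')
  have hlo : (∑ i : Fin c, σ (q (Fin.castLE (le_of_two_mul_le hc) i) (midIndex hc j)) *
      q (Fin.rev (Fin.castLE (le_of_two_mul_le hc) i)) (midIndex hc j')) = 0 :=
    Finset.sum_eq_zero fun i _ => by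
      rw [rev_castLE hc, hq (show blockLabel N c (midIndex hc j') < blockLabel N c (hiIndex hc (Fin.rev i)) by
        rw [blockLabel_midIndex, blockLabel_hiIndex hc]; decide), mul_zero]
  have hhi : (∑ i : Fin c, σ (q (hiIndex hc i) (midIndex hc j)) * q (Fin.rev (hiIndex hc i)) (midIndex hc j')) = 0 :=
    Finset.sum_eq_zero fun i _ => by
      rw [hq (show blockLabel N c (midIndex hc j) < blockLabel N c (hiIndex hc i) by rw [blockLabel_midIndex, blockLabel_hiIndex hc]; decide),
        map_zero, zero_mul]
  rw [map_transpose_mul_wittFormOn_mul_apply e hstd Han hcr hc hN', wittFormOn_midIndex_midIndex e hstd Han hcr hc hN', hlo, hhi, zero_add,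
    add_zero] at h
  rw [Matrix.mul_assoc, Matrix.mul_apply]
  simp only [Matrix.transpose_apply, Matrix.map_apply, midBlock_apply, Matrix.mul_apply]
  exact h

/-- **The first block of a block upper triangular `W`-unitary matrix is invertible together with the last**: the unitarity identity at
`(castLE i, hiIndex i′)` reads `σ(loBlock)ᵀ ·_{rev} hiBlock = 1`-type relations; here we only record that `det` of a `W`-unitary matrix is a unit when
`det W` is (`σ(det q) · det W · det q = det W`). [cite: Rogawski1990, §1.9] -/
theorem isUnit_det_of_unitary_witt (σ : R →+* R) {q : Matrix (Fin N) (Fin N) R} (hW : IsUnit (wittFormOn e Han).det)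
    (hu : (q.map σ)ᵀ * wittFormOn e Han * q = wittFormOn e Han) : IsUnit q.det := by
  have h := congrArg Matrix.det hu
  rw [Matrix.det_mul, Matrix.det_mul, Matrix.det_transpose] at h
  obtain ⟨w, hw⟩ := hW
  rw [← hw] at h
  have h2 : (q.map σ).det * q.det = 1 := by
    have := congrArg (fun x => (↑w⁻¹ : R) * x) h
    simpa [mul_assoc, mul_left_comm, Units.inv_mul_cancel_left] using this
  exact IsUnit.of_mul_eq_one _ (by rwa [mul_comm] at h2)

end Blocks

/-! ## §4 The block-diagonal lift `diag(A, B, A†)` is `W`-unitary when `A′A = 1` and `B` is `W′`-unitary (over a field, as in ★) -/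

section Lift

variable {K : Type*} [Field K] {N r m : ℕ} (e : WittIndex r m ≃ Fin N)
  (hstd : ∀ x, (e x).val = Sum.elim (fun i : Fin r => i.val) (Sum.elim (fun u : Fin m => r + u.val) (fun j : Fin r => r + m + j.val)) x)
  (Han : Matrix (Fin m) (Fin m) K) {c : ℕ} (hcr : c ≤ r) (hc : 2 * c ≤ N) (hN' : (r - c) + (m + (r - c)) = N - 2 * c)

include hstd hcr in
/-- Unitarity of `diag(A, B, A†)` for `W`, rows of the first block: `Σ_k σ(A_{k i}) L_{hiIndex (rev k), b} = W (castLE i) b = [b = rev (castLE i)]`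
(`A† = J σ(A′)ᵀ J`, `A′ A = 1`). [cite: Rogawski1990, §1.9–§1.10] -/
private theorem unitary_witt_row_castLE (σ : K →+* K) {A A' : Matrix (Fin c) (Fin c) K} (hA'A : A' * A = 1)
    (B : Matrix (Fin (N - 2 * c)) (Fin (N - 2 * c)) K) (i : Fin c) (b : Fin N) :
    (∑ k : Fin c, σ (blockDiagMatrix hc A B (dualBlock σ A') (Fin.castLE (le_of_two_mul_le hc) k) (Fin.castLE (le_of_two_mul_le hc) i)) *
        blockDiagMatrix hc A B (dualBlock σ A') (Fin.rev (Fin.castLE (le_of_two_mul_le hc) k)) b) =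
      wittFormOn e Han (Fin.castLE (le_of_two_mul_le hc) i) b := by
  rw [wittFormOn_apply_of_blockLabel_ne_one e hstd Han hcr hc (by rw [blockLabel_castLE hc]; decide)]
  simp only [blockDiagMatrix_castLE_castLE hc, rev_castLE hc]
  by_cases hb : N ≤ (b : ℕ) + c
  · obtain ⟨j, rfl⟩ : ∃ j, hiIndex hc j = b := ⟨⟨b + c - N, by omega⟩, Fin.ext (by simp; omega)⟩
    simp only [blockDiagMatrix_hiIndex_hiIndex hc, dualBlock_apply, Fin.rev_rev, (hiIndex_injective hc).eq_iff]
    have hentry : ∑ k, A' (Fin.rev j) k * A k i = if Fin.rev j = i then 1 else 0 := by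
      rw [← Matrix.mul_apply, hA'A, Matrix.one_apply]
    rw [show (∑ k : Fin c, σ (A k i) * σ (A' (Fin.rev j) k)) = σ (∑ k, A' (Fin.rev j) k * A k i) by
      rw [map_sum]; exact Finset.sum_congr rfl fun k _ => by rw [map_mul, mul_comm], hentry]
    by_cases h : Fin.rev j = i
    · rw [if_pos h, if_pos (by rw [← h, Fin.rev_rev]), map_one]
    · rw [if_neg h, if_neg (fun h' => h (by rw [h', Fin.rev_rev])), map_zero]
  · rw [Finset.sum_eq_zero fun k _ => by rw [blockDiagMatrix_hiIndex_apply_of_lt hc _ _ _ _ (show (b : ℕ) + c < N by omega), mul_zero]]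
    rw [if_neg]
    rintro rfl
    simp only [coe_hiIndex] at hb
    omega

include hstd hcr hN' in
/-- Unitarity of `diag(A, B, A†)` for `W`, rows of the middle block: `Σ_j σ(B_{j i}) Σ_{j′} W′_{j j′} L_{midIndex j′, b} = W (midIndex i) b`
(`B` is `W′`-unitary; the middle block is `W`-orthogonal to the frame). [cite: Rogawski1990, §1.9–§1.10] -/
private theorem unitary_witt_row_midIndex (σ : K →+* K) (A A' : Matrix (Fin c) (Fin c) K) {B : Matrix (Fin (N - 2 * c)) (Fin (N - 2 * c)) K}
    (hB : (B.map σ)ᵀ * wittFormOn (stdWittEquivFin (r - c) m hN') Han * B = wittFormOn (stdWittEquivFin (r - c) m hN') Han)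
    (i : Fin (N - 2 * c)) (b : Fin N) :
    (∑ j : Fin (N - 2 * c), σ (blockDiagMatrix hc A B (dualBlock σ A') (midIndex hc j) (midIndex hc i)) *
        ∑ j' : Fin (N - 2 * c), wittFormOn (stdWittEquivFin (r - c) m hN') Han j j' * blockDiagMatrix hc A B (dualBlock σ A') (midIndex hc j') b) =
      wittFormOn e Han (midIndex hc i) b := by
  simp only [blockDiagMatrix_midIndex_midIndex hc]
  by_cases hb : c ≤ (b : ℕ) ∧ (b : ℕ) + c < N
  · obtain ⟨j'', rfl⟩ : ∃ j, midIndex hc j = b := ⟨⟨b - c, by omega⟩, Fin.ext (by simp; omega)⟩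
    simp only [blockDiagMatrix_midIndex_midIndex hc]
    rw [wittFormOn_midIndex_midIndex e hstd Han hcr hc hN']
    have h := congrFun (congrFun hB i) j''
    rw [Matrix.mul_assoc, Matrix.mul_apply] at h
    simp only [Matrix.transpose_apply, Matrix.map_apply, Matrix.mul_apply] at h
    exact h
  · rw [wittFormOn_midIndex_of_blockLabel_ne_one e hstd Han hcr hc i (fun h1 => hb ((blockLabel_eq_one_iff b).1 h1))]
    exact Finset.sum_eq_zero fun j _ => by
      rw [Finset.sum_eq_zero fun j' _ => by
        rw [blockDiagMatrix_midIndex_apply_of hc _ _ _ _ (show (b : ℕ) < c ∨ N ≤ (b : ℕ) + c by omega), mul_zero], mul_zero]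

include hstd hcr in
/-- Unitarity of `diag(A, B, A†)` for `W`, rows of the last block: `Σ_k σ(A†_{k i}) L_{castLE (rev k), b} = W (hiIndex i) b` (`σ σ = id`, `A′ A = 1`).
[cite: Rogawski1990, §1.9–§1.10] -/
private theorem unitary_witt_row_hiIndex (σ : K →+* K) (hσ : ∀ x, σ (σ x) = x) {A A' : Matrix (Fin c) (Fin c) K} (hA'A : A' * A = 1)
    (B : Matrix (Fin (N - 2 * c)) (Fin (N - 2 * c)) K) (i : Fin c) (b : Fin N) :
    (∑ k : Fin c, σ (blockDiagMatrix hc A B (dualBlock σ A') (hiIndex hc k) (hiIndex hc i)) *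
        blockDiagMatrix hc A B (dualBlock σ A') (Fin.rev (hiIndex hc k)) b) = wittFormOn e Han (hiIndex hc i) b := by
  rw [wittFormOn_apply_of_blockLabel_ne_one e hstd Han hcr hc (by rw [blockLabel_hiIndex hc]; decide)]
  simp only [blockDiagMatrix_hiIndex_hiIndex hc, dualBlock_apply, hσ, rev_hiIndex hc]
  by_cases hb : (b : ℕ) < c
  · obtain ⟨j, rfl⟩ : ∃ j, Fin.castLE (le_of_two_mul_le hc) j = b := ⟨⟨b, hb⟩, Fin.ext (by simp)⟩
    simp only [blockDiagMatrix_castLE_castLE hc, (Fin.castLE_injective _).eq_iff]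
    have hentry : ∑ k, A' (Fin.rev i) k * A k j = if Fin.rev i = j then 1 else 0 := by
      rw [← Matrix.mul_apply, hA'A, Matrix.one_apply]
    rw [← Equiv.sum_comp Fin.revPerm] at hentry
    simp only [Fin.revPerm_apply] at hentry
    rw [hentry]
    by_cases h : Fin.rev i = j
    · rw [if_pos h, if_pos h.symm]
    · rw [if_neg h, if_neg (Ne.symm h)]
  · rw [Finset.sum_eq_zero fun k _ => by rw [blockDiagMatrix_castLE_apply_of_le hc _ _ _ _ (show c ≤ (b : ℕ) by omega), mul_zero]]
    rw [if_neg]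
    rintro rfl
    have := i.isLt
    simp only [Fin.val_castLE, not_lt] at hb
    omega

include hstd hcr hN' in
/-- **`diag(A, B, A†)` is `W`-unitary** for the Witt form `W = wittFormOn e Han` (standard `e`, any anisotropic kernel `Han`) when `A′ A = 1`,
`B` is unitary for the SHIFTED Witt form `W′ = wittFormOn (stdWittEquivFin (r − c) m _) Han`, `A† = J σ(A′)ᵀ J` and `σ` is an involution: the Levi factor
`GL_c × U(σ, W′)` of `Q_c` realised by matrices. [cite: Rogawski1990, §1.9–§1.10] [cite: BruhatTits1972, (4.4.3)] [cite: Borel1991, §23] -/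
theorem blockDiagMatrix_unitary_witt (σ : K →+* K) (hσ : ∀ x, σ (σ x) = x) {A A' : Matrix (Fin c) (Fin c) K} (hA'A : A' * A = 1)
    {B : Matrix (Fin (N - 2 * c)) (Fin (N - 2 * c)) K}
    (hB : (B.map σ)ᵀ * wittFormOn (stdWittEquivFin (r - c) m hN') Han * B = wittFormOn (stdWittEquivFin (r - c) m hN') Han) :
    ((blockDiagMatrix hc A B (dualBlock σ A')).map σ)ᵀ * wittFormOn e Han * blockDiagMatrix hc A B (dualBlock σ A') = wittFormOn e Han := by
  ext a b
  rw [map_transpose_mul_wittFormOn_mul_apply e hstd Han hcr hc hN']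
  obtain ⟨x, rfl⟩ := (blockSum hc).surjective a
  rcases x with (i | i) | i
  · rw [blockSum_inl_inl]
    have hmid : ∀ j : Fin (N - 2 * c), σ (blockDiagMatrix hc A B (dualBlock σ A') (midIndex hc j) (Fin.castLE (le_of_two_mul_le hc) i)) = 0 :=
      fun j => by rw [blockDiagMatrix_midIndex_apply_of hc _ _ _ j (Or.inl (by simp)), map_zero]
    have hhi : ∀ k : Fin c, σ (blockDiagMatrix hc A B (dualBlock σ A') (hiIndex hc k) (Fin.castLE (le_of_two_mul_le hc) i)) = 0 :=
      fun k => by rw [blockDiagMatrix_hiIndex_apply_of_lt hc _ _ _ k (by simp; omega), map_zero]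
    simp only [hmid, hhi, zero_mul, Finset.sum_const_zero, add_zero]
    exact unitary_witt_row_castLE e hstd Han hcr hc σ hA'A B i b
  · rw [blockSum_inl_inr]
    have hlo : ∀ k : Fin c, σ (blockDiagMatrix hc A B (dualBlock σ A') (Fin.castLE (le_of_two_mul_le hc) k) (midIndex hc i)) = 0 :=
      fun k => by rw [blockDiagMatrix_castLE_apply_of_le hc _ _ _ k (by simp), map_zero]
    have hhi : ∀ k : Fin c, σ (blockDiagMatrix hc A B (dualBlock σ A') (hiIndex hc k) (midIndex hc i)) = 0 :=
      fun k => by rw [blockDiagMatrix_hiIndex_apply_of_lt hc _ _ _ k (by simp; omega), map_zero]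
    simp only [hlo, hhi, zero_mul, Finset.sum_const_zero, zero_add, add_zero]
    exact unitary_witt_row_midIndex e hstd Han hcr hc hN' σ A A' hB i b
  · rw [blockSum_inr]
    have hlo : ∀ k : Fin c, σ (blockDiagMatrix hc A B (dualBlock σ A') (Fin.castLE (le_of_two_mul_le hc) k) (hiIndex hc i)) = 0 :=
      fun k => by rw [blockDiagMatrix_castLE_apply_of_le hc _ _ _ k (by simp; omega), map_zero]
    have hmid : ∀ j : Fin (N - 2 * c), σ (blockDiagMatrix hc A B (dualBlock σ A') (midIndex hc j) (hiIndex hc i)) = 0 :=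
      fun j => by rw [blockDiagMatrix_midIndex_apply_of hc _ _ _ j (Or.inr (by simp; omega)), map_zero]
    simp only [hlo, hmid, zero_mul, Finset.sum_const_zero, zero_add]
    exact unitary_witt_row_hiIndex e hstd Han hcr hc σ hσ hA'A B i b

end Lift

end Summit.HodgeConjecture.HodgeConjecture.Cruxes.H413.K2E3WittParabolicBlocks

end
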